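import Mathlib
import HarnessLib
import HarnessLib.Audit
import Summits.RiemannHypothesis.Statement
import Literature.NumberTheory.LFunctions.RiemannXi
import Literature.NumberTheory.LFunctions.ZetaScrewLaplace
import Summits.RiemannHypothesis.RiemannHypothesis.Theorems.Splittings.PolyDoorRealAxis
import Summits.RiemannHypothesis.RiemannHypothesis.Theorems.Splittings.PolyDoorLaguerre
import Summits.RiemannHypothesis.RiemannHypothesis.Theorems.Splittings.PolyDoorDomination
import Summits.RiemannHypothesis.RiemannHypothesis.Theorems.Splittings.PolyDoorLocalSign
import Summits.RiemannHypothesis.RiemannHypothesis.Theorems.Splittings.PolyDoorNegative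
import Summits.RiemannHypothesis.RiemannHypothesis.Theorems.Splittings.PolyDoorDichotomy
import Summits.RiemannHypothesis.RiemannHypothesis.Theorems.Splittings.PolyDoorCount
import HarnessLib.Audit.Status.Attr

/-!
Route: DeBrangesSuzukiDoor

# Route DeBrangesSuzukiDoor — one fixed Suzuki operator — the RH-free door «W_θ ∈ L² ⟹ RH» (kernel
support + Laplace identity PROVED; rigidity port), concluding the rung leaf B-P; residual = the
witness

X = WitnessDetectsRH ∧ DoorWitness ("it suffices to show"). Fix Suzuki's SINGLE symbol Θ_θ(z) =
exp(−2θ(ξ′/ξ)(½−iz))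
([Su20] = Suzuki2020IntegralOperators (1.10)), its spectral kernel K_θ(x) = Re (2π)⁻¹∫_{Im z=1}
Θ_θ(z)e^{−izx}dz and the one
explicit window function W_θ(x) = ∫₀¹ K_θ(x+y)dy. WitnessDetectsRH (RH-FREE, the rung leaf B-P of
column DBR): for every
θ > 10, W_θ ∈ L²(ℝ) ⟹ RH. It splits as KernelSupport (K3: K_θ = 0 on x < 0 — PROVED,
`Theorems.kernelSupport_proof`, 2026-08-25) + KernelLaplaceIdentity
(K4: Θ_θ(z) = ∫₀^∞ K_θ(x)e^{izx}dx absolutely on Im z > 1 — PROVED,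
`Theorems.kernelLaplaceIdentity_proof`) + DoorModuloKernel (H1
symbol-quotient + H2 no-blind-spot rigidity + K1/K2 regularity — PROVED,
`Theorems.doorModuloKernel_proof`, p410258); the leaf itself is PROVED as an item
(`Theorems.witnessDetectsRH_proof`, p410667, 2026-08-25) — EVERY RH-FREE item of this route is
closed. DoorWitness (∃ θ > 10, W_θ ∈ L²) is the DECLARED RESIDUAL:
RH-EQUIVALENT·DERIVED (⟸ by WitnessDetectsRH; ⟹ by the inner-function isometry under RH, ∫W_θ² = 1),
never a proving target.
Lean: `WitnessDetectsRH ∧ DoorWitness`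

## Assembly
Pure logic (sorry-free, axioms propext/Classical.choice/Quot.sound). RE-TARGETED (D-0061, class
rung, never summit credit): the
deciding theorem `closes (hS : KernelSupport) (hL : KernelLaplaceIdentity) (hD : DoorModuloKernel) :
WitnessDetectsRH :=
fun θ hθ hMem => hD θ hθ (hS θ hθ) (hL θ hθ) hMem` concludes the REGISTERED RUNG LEAF B-P
`WitnessDetectsRH` (RH-FREE; all three binders PROVED); the
residual DoorWitness is no longer a binder (aside of record, RH-EQUIVALENT·DERIVED). The item
Assembly still records the conjunct
split X = WitnessDetectsRH ∧ DoorWitness → summit (WitnessDetectsRH the conjunct attacked,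
DoorWitness the named residual); the
window-language strengthening of the leaf is route SuzukiWindowsDoor (B-P(P2)).

CLOSES_TARGET: closes rung B-P of RiemannHypothesis: Summit.RiemannHypothesis.RiemannHypothesis.Theses.DeBrangesSuzukiDoor.WitnessDetectsRH (D-0061; not the summit Statement) — the deciding theorem of this route concludes that registered leaf instead of the Statement decl `RiemannHypothesis` (class rung: servable and labelled, never counted as concluding the summit Statement).

Rationale: WHY THIS LINE. [Su20] (Suzuki2020IntegralOperators, arXiv:1907.07302) p. 2 prints the wish for "an
equivalent condition using only one single
operator avoiding parameters ω and ν" and proves for K_θ only Thm 1.2 (K-ii)–(K-v), leaving the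
RH-relation open; the family
criterion is Suzuki2021Hamiltonians (arXiv:1606.05726) Thm 2.1/Prop. 4.3–4.4, a de Branges
canonical-system door with a blind
spot at each fixed (ω,ν). The typed observation of this column (TARGET-v3 §G): K_θ has NO blind spot
— an off-line zero ρ₀ puts a
non-cancellable essential singularity exp(2θm/(i(z−z₀))) of Θ_θ inside ℂ₊, so any tempered witness
forcing "Θ_θ = quotient of two
ℂ₊-holomorphic functions on Im z > c" gives RH (H1 Paley–Wiener/Laplace quotient, H2 rigidity via
LagariasXiPositivity1999-type
log-derivative bookkeeping — both PROVED RH-free, referee PASS 0 SMUGGLED). Imported areas: de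
Branges spaces / canonical systems
(operator theory), Paley–Wiener and Laplace-transform uniqueness (harmonic analysis), Stirling
bounds for ψ = Γ′/Γ (special
functions). What it does that prior routes do not: route-RiemannHypothesis-DeBrangesShift bets on de
Branges POSITIVITY of shifted
spaces (negative side, Conrey–Li obstruction); this line uses no positivity at all — only support +
Laplace identity of ONE kernel —
and lands an RH-free door theorem whose data side (K_θ, W_θ, ∫W_θ²) is already banked to 13+ digits
(DATA-1b, DATA-5).
First rung (BC5, in tree): `Literature.NumberTheory.LFunctions.Suzuki2023_thm11_fourier_holds`
(Suzuki2023 = arXiv:2206.03682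
Thm 1.1 (1), PROVED RH-free) is the same one-sided Fourier–Laplace door `∫₀^∞ k(x)e^{izx}dx =
symbol(z)` for the screw kernel Ψ,
whose symbol −z⁻²(ξ′/ξ)(½−iz) is the θ-linearisation of log Θ_θ; its S-side (Ψ ≥ 0 ⟺ RH, Suzuki2023
Thm 1.7) is open — exactly
the shape KernelLaplaceIdentity/DoorWitness has here.

RANKED CRUXES. #2 KernelLaplaceIdentity (crux) — RH-FREE — CLOSED·PROVED 2026-08-25
(`Summit.RiemannHypothesis.RiemannHypothesis.Theorems.kernelLaplaceIdentity_proof`, from the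
Literature theorem `Suzuki2020_thm12_laplace`, all θ > 1) — K4: for every θ > 10 and every z with Im
z > 1, x ↦ K_θ(x)e^{izx} is integrable on (0,∞) and ∫₀^∞ K_θ(x)e^{izx}dx = Θ_θ(z) ([Su20] Thm 1.2
(K-ii) second clause, printed for θ > 1, Im z > ½, for the series-defined kernel; here for the
spectrally defined one). [deps: KernelSupport] [difficulty: L] (why it might fail: as typed K_θ is
the inverse Fourier integral on Im z = 1 (junk 0 if non-integrable — excluded for θ > 10 by the
proved line integrability); Fourier inversion needs Θ_θ(·+ib) ∈ L¹ ∩ C⁰ uniformly in b ≥ 1 and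
|K_θ(x)| ≤ Ce^x, else the (0,∞)-integral diverges for 1 < Im z ≤ 1+ε.) [Suzuki2020IntegralOperators,
Suzuki2021Hamiltonians, arXiv:1907.07302]
#3 KernelSupport (crux) — RH-FREE — CLOSED·PROVED 2026-08-25 (`…Theorems.kernelSupport_proof`, from
`Suzuki2020_thm12_Kiii`) — K3: for every θ > 10 the spectral kernel K_θ vanishes on (−∞,0) ([Su20]
Thm 1.2 (K-iii), printed for θ > 1 via the Bessel series of g_θ; here by contour shift Im z = 1 → Im
z = b → ∞ using |Θ_θ(u+ib)| ≤ C((b+½)²+u²)^(−θ/2) from Stirling for ψ and |ζ′/ζ| ≤ −ζ′/ζ(3/2) on Re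
s ≥ 3/2). [difficulty: M] (why it might fail: the uniform-in-b decay needs Re ψ(s/2) ≥ log|s/2| −
O(1/|s|) on Re s ≥ 3/2 with an explicit constant; `norm_digamma_sub_log_le` degrades near the
imaginary axis and the Re(θψ) bookkeeping (arg(s/2)·Im ψ) must keep the sign, else no uniform
majorant as b → ∞.) [Suzuki2020IntegralOperators, arXiv:1907.07302, LagariasXiPositivity1999]
#7 DoorWitness (crux) — DECLARED RESIDUAL (RH-EQUIVALENT·DERIVED; refutation budget only, never a
proving target): there is θ > 10 with W_θ ∈ L²(ℝ). Under RH, Θ_θ is inner on ℂ₊ and ∫W_θ² = 1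
exactly; a certified value ∫_{−1}^X W_θ² > 1 at any finite X refutes RH (DATA-5 Q12: m_θ(X) ≤ 1 with
deficit 2.05e-2…3.04e-2 at X = 5, θ ∈ {5/4,3/2,2,3}). [difficulty: open-problem] (why it might fail:
it is equivalent to RH given the RH-free items (WitnessDetectsRH ⟸; inner-function isometry ⟹):
exactly as hard as the summit — filed only as the named residual conjunct of X, so that the route's
RH-free content is load-bearing and typed.) [Suzuki2020IntegralOperators, LagariasXiPositivity1999,
deBranges1986, ConreyLi2000]
#9 DoorModuloKernel (support) — RH-FREE — CLOSED·PROVED 2026-08-25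
(`…Theorems.doorModuloKernel_proof`, p410258; port of HOME scratch `SuzukiCanonicalWindow.lean`
sha16 82bfcc5f80debbaf, referee read PASS) — H1 ∧ H2 ∧ K1 ∧ K2 packaged: for θ > 10, if K_θ = 0 on
(−∞,0) and the Laplace identity holds on Im z > 1, then W_θ ∈ L² ⟹ RH. Landed as
Theorems/DeBrangesSuzukiDoor{SymbolRigidity,LaplaceWindow,DoorModuloKernel}.lean. [difficulty:
provable-now — done] [Suzuki2020IntegralOperators, LagariasXiPositivity1999]
#9 WitnessDetectsRH (aside = THE RUNG LEAF B-P, RH-FREE door theorem, hypothesis-free form; now the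
route's closes_target) — CLOSED·PROVED 2026-08-25 (`…Theorems.witnessDetectsRH_proof`, p410667): for
every θ > 10, W_θ ∈ L²(ℝ) ⟹ RH — `closes` concludes it from KernelSupport + KernelLaplaceIdentity +
DoorModuloKernel (all PROVED). [difficulty: L — done] [Suzuki2020IntegralOperators,
Suzuki2021Hamiltonians]

TWO-LAYER PLAN. KernelSupport ⇐ SymbolDecayUniform (∀θ>10 ∃C ∀b≥1 ∀u, ‖Θ_θ(u+ib)‖ ≤
C((b+½)²+u²)^(−θ/2)) → LineIndependence (∀b≥1, invFourierLine
Θ_θ 1 = invFourierLine Θ_θ b, Cauchy on rectangles + decay) → KernelSupport (let b → ∞ for x < 0).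
KernelLaplaceIdentity ⇐
SymbolDecayUniform → KernelReality ((invFourierLine Θ_θ b x).im = 0 from ξ(conj s) = conj ξ(s)) →
generic Fourier–Laplace inversion
on a line (Mathlib `Continuous.fourier_fourierInv_eq`, Mathlib/Analysis/Fourier/Inversion.lean,
2π-rescaled) → KernelLaplaceIdentity. Both splits are MOOT since 2026-08-25: K3/K4 closed directly
from the Literature theorems of [Su20] Thm 1.2 (p408554); the skeleton stubs stay registered as
history. The window-language expansion (A1 `WindowsImplyContraction`) lives on route
SuzukiWindowsDoor, not here (bc6).

KILL CRITERIA. A certified ∫_{−1}^X W_θ² > 1 (any θ > 0, any X; DATA-5 pipeline, interval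
arithmetic) refutes DoorWitness AND RH — close
`refuted:DoorWitness` and hand the certificate to the summit's negative side. A proof that the
spectral K_θ (line Im z = 1) differs
from Suzuki's series kernel Σλ_θ(n)n^(−1/2)g_θ(x−log n) on x ≥ 0 (DATA-1b says they agree to
13.3–14.9 digits) or that K_θ(x) ≠ 0
for some x < 0, θ > 10 refutes KernelSupport/KernelLaplaceIdentity as TYPED (misstated: repair =
move the defining line / fix 2π
conventions of `invFourierLine`), not the door. WitnessDetectsRH landed elsewhere (e.g. from the
named fact Suzuki2020_thm12 (landed p402789, 2026-08-25)
PROVED) moots K3/K4. The route never closes the summit unless someone proves DoorWitness, which is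
RH itself: its deliverable is the rung.

NOT DECOMPOSED YET. The uniform symbol decay constant, the rectangle-contour bookkeeping, reality of
K_θ, and the 2π/sign conventions between
`invFourierLine` and Mathlib's `𝓕` (layer-2 children of K3/K4, filed as BC3 stubs, not items); the
port of DoorModuloKernel is one
support item, not split (it is a mechanical transfer of a checked file); the RH ⟹ DoorWitness
direction (criterion-I, inner-function
isometry) is deliberately NOT an item — it bears on no rung and is RH-conditional.

CHEAPEST FALSIFIER. Numerical, already run (kit j240357 DATA-1b, j243268 DATA-5; HOME/DATA.md sha16
e0328183f99bab2f): lineage A (spectral, the typed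
K_θ on Re s = 3/2) ≡ lineage B (Suzuki's arithmetic series, which is 0 on x < 0 by construction) to
13.3–14.9 digits at 200 points ×
θ ∈ {5/4, 3/2, 2, 3} — consistent with K3/K4; m_θ(5) = ∫_{−1}^5 W_θ² ≤ 1 with deficit 2–3·10⁻² —
consistent with DoorWitness. The
cheapest in-Lean kill of the TYPING: evaluate the sign/2π convention of
`Literature.NumberTheory.LFunctions.invFourierLine` against
`norm_invFourierLine_le` / `continuous_invFourierLine_re` (used in the scratch proofs, so the
convention is the one K1/K2 were proved in).

NUMBERS. θ-regime: items typed at θ > 10 (line integrability of Θ_θ(·+i) PROVED there: majorant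
e^(θ(π+1))(1+|u|)^(−θ/10)); printed regime θ > 1
([Su20] Thm 1.2). Growth: |K_θ(x)| ≤ (‖Θ_θ(·+i)‖₁/2π)e^x PROVED (printed: ≪ e^(x/2)). Data: K_θ gate
A≡B 13.3–14.9 digits (DATA-1b);
m_θ(X) ≤ 1, 1 − m_θ(5) = 2.05e-2…3.04e-2 ~ X^(−0.28…−0.39) (DATA-5 Q12); ‖𝖪[T]‖ < 1 certificates at
T = (log 2)/2, 1/2 for all 7
(ω,ν) rows (S2/Q10). Items: 6 (K3, K4, DoorModuloKernel, WitnessDetectsRH = closes_target, Assembly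
ALL PROVED; residual DoorWitness aside of record).

DEFINITION REQUESTS. None blocking: Θ_θ/K_θ/W_θ are inlined with `let` over
`Literature.NumberTheory.LFunctions.riemannXi` and `…invFourierLine`
(bodies verbatim the Literature defs `Literature.NumberTheory.LFunctions.limTheta`/`limKernel` of
`SuzukiSingleOperatorKernel.lean`
(p402789, ACCEPTED 2026-08-25T20:49Z); the match is `rfl` (checked, FromPrint.lean)). The named fact
`Suzuki2020_thm12` = [Su20] Thm 1.2 (K-ii)–(K-v)
implies KernelSupport and KernelLaplaceIdentity as typed (kernel-checked; gate class
proof.conditional, credits nothing) — the items ask for unconditional proofs.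

Novelty: Searches (2026-08-25, corpus fts+vec AND galaxy, TARGET-v3 §G.6): `lit search --hybrid "single
integral operator Riemann hypothesis
eigenvalue window Suzuki"` (hits: [corpus:paper-arxiv-1907.07302 p.2–3] the printed wish + Thm 1.2
only; [corpus:paper-arxiv-2012.11121
p.9] "the method may also generalize to u = exp(−2ηξ′/ξ)", no criterion); `lit vsearch "RH holds iff
a single explicit window function
of Suzuki's kernel K_theta is square integrable"` (0 relevant); `lit galaxy search "K_theta|single
operator|Suzuki kernel" --star all`
(0 relevant beyond [Su20]); `lit citing arxiv:1907.07302` → 2 works (arXiv:2012.11121,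
arXiv:1907.07838), neither states a single-operator
criterion; grep of held Suzuki papers arXiv:2206.03682, 2301.00421, 2209.04658, 1606.05726,
2411.07436 for «single operator|λ_θ|Ihara» → 0.
Nearest prior art found: Suzuki2020IntegralOperators (arXiv:1907.07302: K_θ, Thm 1.2, the open
wish), Suzuki2021Hamiltonians
(arXiv:1606.05726 Thm 2.1, Prop 4.3/4.4: the (ω,ν)-family criterion), LagariasXiPositivity1999 (Re
ξ′/ξ > 0 on Re s > ½ ⟺ RH, tree-proved
`Lagarias1999_riemannHypothesis_iff_holds`), Lagarias2006 (de Branges structure functions from ξ).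
Delta: the RH-detecting direction for ONE fixed operator — "W_θ ∈ L² ⟹ RH" via the no-blind-spot
essential-singularity rigidity of
Θ_θ — is not in print (Suzuki proves only (K-ii)–(K-v) and asks the question); the route lands it
RH-free and types the residual honestly.
Claimed grade: new-combination  [refs: 1907.07302, 2012.11121, 1907.07838, 2206.03682, 1606.05726, paper-arxiv-1907.07302, paper-arxiv-2012.11121, arxiv:1907.07302, LagariasXiPositivity1999, Lagarias2006]

Barriers (technique_class: single-operator-kernel, laplace-symbol-rigidity): - technique_class: single-operator-kernel, laplace-symbol-rigidity
- Literature.Barriers.RiemannHypothesis.DeBrangesPositivity: OUTSIDE — the line uses no positivity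
of a de Branges space / no Conrey–Li kernel condition (ConreyLi2000 Thm 1–2, §3.1 failure for ζ);
its RH-free content is support + Laplace identity of one kernel and a Laplace-quotient rigidity, and
the residual is an L² statement about one explicit function, not a positivity axiom. The barrier
bites only if one tried to prove DoorWitness via de Branges positivity — nobody is asked to.
- Literature.Barriers.RiemannHypothesis.BohrDenseValues: does not apply — no value-distribution /
universality statement on a vertical line inside the strip is used; all RH-free items live on Re s ≥
3/2 (absolute convergence) and the rigidity step is about meromorphic continuation, not about
values.
- Literature.Barriers.RiemannHypothesis.NymanBeurlingObstructions: does not apply — no L²(0,1)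
approximation / Báez-Duarte distance is involved; the L² object here is W_θ on ℝ and only its
RH-FREE consequences are load-bearing.
- Negatives index: the two refuted RH statements (stmt-RiemannHypothesis-16980 character-sum
positivity; stmt-RiemannHypothesis-2575 universal-factor Laplace loophole) are unrelated to K_θ;
nothing here restates them.

History (route lifecycle, newest last):
- 2026-08-26T00:30:21Z · closes_target -> closes rung B-P of RiemannHypothesis: Summit.RiemannHypothesis.RiemannHypothesis.Theses.DeBrangesSuzukiDoor.WitnessDetectsRH (D-0061; not the summit Statement) (planner-rh-dbr-theory-g5-0)

sub-problem: RiemannHypothesis · status: open · opened planner-rh-dbr-theory-g4-0 2026-08-25T20:19:42Z · rev 5 · ledger route-RiemannHypothesis-DeBrangesSuzukiDoor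
GENERATED by the gate from the ledger (D-0016/17). Provers cite these decls: `theorem foo : Summit.RiemannHypothesis.RiemannHypothesis.Theses.DeBrangesSuzukiDoor.<Decl> := …` in Summits/RiemannHypothesis/RiemannHypothesis/Theorems/<Name>.lean.
-/

namespace Summit.RiemannHypothesis.RiemannHypothesis.Theses.DeBrangesSuzukiDoor

open scoped BigOperators Topology Manifold Classical MeasureTheory ProbabilityTheory Matrix InnerProductSpace ComplexConjugate ContinuousMap
open Filter Set Function TopologicalSpace MeasureTheory

attribute [summit_statement] _root_.Summit.RiemannHypothesis
-- H21.Audit: the closer leaf Summit.RiemannHypothesis.RiemannHypothesis.Theses.DeBrangesSuzukiDoor.WitnessDetectsRH is an item decl of this route file — tagged summit_statement below, after its declaration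

open Summit

/-- item stmt-RiemannHypothesis-19726 · crux · rank 2 · closed · proved by Summit.RiemannHypothesis.RiemannHypothesis.Theorems.kernelLaplaceIdentity_proof @ 325b10ddc517 (prover) · by planner
why it might fail: as typed K_θ is the inverse Fourier integral on Im z = 1 (junk 0 if non-integrable — excluded for θ > 10 by the proved line integrability); Fourier inversion needs Θ_θ(·+ib) ∈ L¹ ∩ C⁰ uniformly in b ≥ 1 and |K_θ(x)| ≤ Ce^x, else the (0,∞)-integral diverges for 1 < Im z ≤ 1+ε.
sources: Suzuki2020IntegralOperators, Suzuki2021Hamiltonians, arXiv:1907.07302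
[crux] K4 — for every θ > 10 and every z with Im z > 1, x ↦ K_θ(x)e^{izx} is integrable on (0,∞) and
∫₀^∞ K_θ(x)e^{izx}dx = Θ_θ(z) ([Su20] Thm 1.2 (K-ii) second clause, printed for θ > 1, Im z > ½, for
the series-defined kernel; here for the spectrally defined one). [deps: KernelSupport] [difficulty:
L] -/
@[route_item "route-RiemannHypothesis-DeBrangesSuzukiDoor", crux]
def KernelLaplaceIdentity : Prop :=
  ∀ θ : ℝ, 10 < θ → let Θ : ℂ → ℂ := fun z => Complex.exp (-2 * (θ : ℂ) * (deriv Literature.NumberTheory.LFunctions.riemannXi (1 / 2 - Complex.I * z) / Literature.NumberTheory.LFunctions.riemannXi (1 / 2 - Complex.I * z))); let K : ℝ → ℝ := fun x => ((1 : ℂ) / (2 * (Real.pi : ℂ)) * ∫ u : ℝ, Θ ((u : ℂ) + ((1 : ℝ) : ℂ) * Complex.I) * Complex.exp (-Complex.I * ((u : ℂ) + ((1 : ℝ) : ℂ) * Complex.I) * (x : ℂ))).re; ∀ z : ℂ, 1 < z.im → MeasureTheory.IntegrableOn (fun x : ℝ => (K x : ℂ) * Complex.exp (Complex.I * z * (x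 : ℂ))) (Set.Ioi 0) ∧ ∫ x in Set.Ioi (0 : ℝ), (K x : ℂ) * Complex.exp (Complex.I * z * (x : ℂ)) = Θ z

-- `KernelLaplaceIdentity` holds: proved by `Summit.RiemannHypothesis.RiemannHypothesis.Theorems.kernelLaplaceIdentity_proof` @ 325b10ddc517 (its module imports this route file, so no `_holds` link can be stated here).

/-- item stmt-RiemannHypothesis-19727 · crux · rank 3 · closed · proved by Summit.RiemannHypothesis.RiemannHypothesis.Theorems.kernelSupport_proof @ 325b10ddc517 (prover) · by planner
why it might fail: the uniform-in-b decay needs Re ψ(s/2) ≥ log|s/2| − O(1/|s|) on Re s ≥ 3/2 with an explicit constant; `norm_digamma_sub_log_le` degrades near the imaginary axis and the Re(θψ) bookkeeping (arg(s/2)·Im ψ) must keep the sign, else no uniform majorant as b → ∞.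
sources: Suzuki2020IntegralOperators, arXiv:1907.07302, LagariasXiPositivity1999
[crux] K3 — for every θ > 10 the spectral kernel K_θ vanishes on (−∞,0) ([Su20] Thm 1.2 (K-iii),
printed for θ > 1 via the Bessel series of g_θ; here by contour shift Im z = 1 → Im z = b → ∞ using
|Θ_θ(u+ib)| ≤ C((b+½)²+u²)^(−θ/2) from Stirling for ψ and |ζ′/ζ| ≤ −ζ′/ζ(3/2) on Re s ≥ 3/2).
[difficulty: M] -/
@[route_item "route-RiemannHypothesis-DeBrangesSuzukiDoor", crux]
def KernelSupport : Prop :=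
  ∀ θ : ℝ, 10 < θ → let Θ : ℂ → ℂ := fun z => Complex.exp (-2 * (θ : ℂ) * (deriv Literature.NumberTheory.LFunctions.riemannXi (1 / 2 - Complex.I * z) / Literature.NumberTheory.LFunctions.riemannXi (1 / 2 - Complex.I * z))); let K : ℝ → ℝ := fun x => ((1 : ℂ) / (2 * (Real.pi : ℂ)) * ∫ u : ℝ, Θ ((u : ℂ) + ((1 : ℝ) : ℂ) * Complex.I) * Complex.exp (-Complex.I * ((u : ℂ) + ((1 : ℝ) : ℂ) * Complex.I) * (x : ℂ))).re; ∀ x : ℝ, x < 0 → K x = 0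

-- `KernelSupport` holds: proved by `Summit.RiemannHypothesis.RiemannHypothesis.Theorems.kernelSupport_proof` @ 325b10ddc517 (its module imports this route file, so no `_holds` link can be stated here).

/-- item stmt-RiemannHypothesis-19728 · crux · rank 7 · open · by planner
why it might fail: it is equivalent to RH given the RH-free items (WitnessDetectsRH ⟸; inner-function isometry ⟹): exactly as hard as the summit — filed only as the named residual conjunct of X, so that the route's RH-free content is load-bearing and typed.
sources: Suzuki2020IntegralOperators, LagariasXiPositivity1999, deBranges1986, ConreyLi2000
[crux] DECLARED RESIDUAL (RH-EQUIVALENT·DERIVED; refutation budget only, never a proving target):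
there is θ > 10 with W_θ ∈ L²(ℝ). Under RH, Θ_θ is inner on ℂ₊ and ∫W_θ² = 1 exactly; a certified
value ∫_{−1}^X W_θ² > 1 at any finite X refutes RH (DATA-5 Q12: m_θ(X) ≤ 1 with deficit
2.05e-2…3.04e-2 at X = 5, θ ∈ {5/4,3/2,2,3}). [difficulty: open-problem] -/
@[route_item "route-RiemannHypothesis-DeBrangesSuzukiDoor"]
def DoorWitness : Prop :=
  ∃ θ : ℝ, 10 < θ ∧ let Θ : ℂ → ℂ := fun z => Complex.exp (-2 * (θ : ℂ) * (deriv Literature.NumberTheory.LFunctions.riemannXi (1 / 2 - Complex.I * z) / Literature.NumberTheory.LFunctions.riemannXi (1 / 2 - Complex.I * z))); let K : ℝ → ℝ := fun x => ((1 : ℂ) / (2 * (Real.pi : ℂ)) * ∫ u : ℝ, Θ ((u : ℂ) + ((1 : ℝ) : ℂ) * Complex.I) * Complex.exp (-Complex.I * ((u : ℂ) + ((1 : ℝ) : ℂ) * Complex.I) * (x : ℂ))).re; MeasureTheory.MemLp (fun x : ℝ => ∫ y in Set.Ioo (0 : ℝ) 1, K (x + y)) 2 MeasureTheory.volume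

/-- item stmt-RiemannHypothesis-19729 · support · rank 9 · closed · proved by Summit.RiemannHypothesis.RiemannHypothesis.Theorems.doorModuloKernel_proof @ 8fad82edbe77 (prover) · by planner
sources: Suzuki2020IntegralOperators, LagariasXiPositivity1999
[support] H1 ∧ H2 ∧ K1 ∧ K2 packaged (PROVED RH-free in HOME scratch `SuzukiCanonicalWindow.lean`
sha16 82bfcc5f80debbaf as `rh_of_limTemperedWitness_of_K34`, referee read PASS): for θ > 10, if K_θ
= 0 on (−∞,0) and the Laplace identity holds on Im z > 1, then W_θ ∈ L² ⟹ RH. Port target: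
Theorems/DeBrangesSuzukiDoorDoorModuloKernel.lean (≈ 2.5 kLoC scratch → tree). [difficulty:
provable-now] -/
@[route_item "route-RiemannHypothesis-DeBrangesSuzukiDoor", crux]
def DoorModuloKernel : Prop :=
  ∀ θ : ℝ, 10 < θ → let Θ : ℂ → ℂ := fun z => Complex.exp (-2 * (θ : ℂ) * (deriv Literature.NumberTheory.LFunctions.riemannXi (1 / 2 - Complex.I * z) / Literature.NumberTheory.LFunctions.riemannXi (1 / 2 - Complex.I * z))); let K : ℝ → ℝ := fun x => ((1 : ℂ) / (2 * (Real.pi : ℂ)) * ∫ u : ℝ, Θ ((u : ℂ) + ((1 : ℝ) : ℂ) * Complex.I) * Complex.exp (-Complex.I * ((u : ℂ) + ((1 : ℝ) : ℂ) * Complex.I) * (x : ℂ))).re; (∀ x : ℝ, x < 0 → K x = 0) → (∀ z : ℂ, 1 < z.im → MeasureTheory.IntegrableOn (fun x : ℝ => (K x : ℂ) * Complex.exp (Complex.I * z * (x : ℂ))) (Set.Ioi 0) ∧ ∫ x in Set.Ioi (0 : ℝ), (K x : ℂ) * Complex.exp (Complex.I * z * (x : ℂ)) = Θ z) → MeasureTheory.MemLp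 (fun x : ℝ => ∫ y in Set.Ioo (0 : ℝ) 1, K (x + y)) 2 MeasureTheory.volume → _root_.RiemannHypothesis

-- `DoorModuloKernel` holds: proved by `Summit.RiemannHypothesis.RiemannHypothesis.Theorems.doorModuloKernel_proof` @ 8fad82edbe77 (its module imports this route file, so no `_holds` link can be stated here).

/-- item stmt-RiemannHypothesis-19730 · aside · rank 9 · closed · proved by Summit.RiemannHypothesis.RiemannHypothesis.Theorems.witnessDetectsRH_proof @ 5a27e39647fb (prover) · by planner
sources: Suzuki2020IntegralOperators, Suzuki2021Hamiltonians
[support] THE RUNG LEAF B-P (RH-FREE door theorem, hypothesis-free form): for every θ > 10, W_θ ∈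
L²(ℝ) ⟹ RH. Derived inside `closes` from KernelSupport + KernelLaplaceIdentity + DoorModuloKernel
(`witnessDetectsRH_of` in Sketch.lean); the constant alt-closer routes may conclude (D-0061).
[difficulty: L] -/
@[route_item "route-RiemannHypothesis-DeBrangesSuzukiDoor"]
def WitnessDetectsRH : Prop :=
  ∀ θ : ℝ, 10 < θ → let Θ : ℂ → ℂ := fun z => Complex.exp (-2 * (θ : ℂ) * (deriv Literature.NumberTheory.LFunctions.riemannXi (1 / 2 - Complex.I * z) / Literature.NumberTheory.LFunctions.riemannXi (1 / 2 - Complex.I * z))); let K : ℝ → ℝ := fun x => ((1 : ℂ) / (2 * (Real.pi : ℂ)) * ∫ u : ℝ, Θ ((u : ℂ) + ((1 : ℝ) : ℂ) * Complex.I) * Complex.exp (-Complex.I * ((u : ℂ) + ((1 : ℝ) : ℂ) * Complex.I) * (x : ℂ))).re; MeasureTheory.MemLp (fun x : ℝ => ∫ y in Set.Ioo (0 : ℝ) 1, K (x + y)) 2 MeasureTheory.volume → _root_.RiemannHypothesis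

-- `WitnessDetectsRH` holds: proved by `Summit.RiemannHypothesis.RiemannHypothesis.Theorems.witnessDetectsRH_proof` @ 5a27e39647fb (its module imports this route file, so no `_holds` link can be stated here).

/-- item stmt-RiemannHypothesis-21496 · support · rank 9 · closed · proved by Summit.RiemannHypothesis.RiemannHypothesis.Theorems.Splittings.PolyDoorRealAxis.polyDoorRealAxis (prover) · by planner
[support] LINE L12 / B0 «DBR POLYNOMIAL DOOR» (D-0145; registrar rh-split-dbr-neg g16 by verb (ii),
RULINGS #253/#257) — NODE 1 of 5 (real axis; S-sized): a real zero x of the polynomial door E_p :=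
p_ℂ + i·p_ℂ′ is a common zero of p and p′ (real and imaginary parts vanish separately). E-GENERAL,
RH-FREE (no zeta, Mathlib only); = `RealAxisNode` of HOME/rh-split-dbr-neg/g15/LineDbrB0.lean
fbf1fd8c172cea0f verbatim (definitional `Iff.rfl`, kernel
HOME/rh-split-dbr-neg/g16/l12/L12B0Items.lean 2214cd41f05abd8a rc 0; BC7 probe CLEAN; `exact?` dedup
FAIL). Role in the line: bookkeeping for the target PolyDoorDichotomy / apex PolyDoorCount (real
zeros of E_p = multiple real roots of p). NOT in the cone of this route's `closes`
(WitnessDetectsRH): a provable RUNG of the negative-lens mechanism «a non-real zero of A forces a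
zero of A + iA′ in ℂ₊» (card cards/SPLIT-dbr-neg.md §20 THEOREM B / COROLLARY M at h = 0), 0 summit
credit. Cheapest falsifier: lineB_num.py 45/45 (g15). Source: Levin, Distribution of zeros of entire
functions, ch. VII (Hermite–Biehler); card §20. Nothing here bears on the truth of RH. -/
@[route_item "route-RiemannHypothesis-DeBrangesSuzukiDoor"]
def PolyDoorRealAxis : Prop :=
  ∀ (p : Polynomial ℝ) (x : ℝ), (p.map (algebraMap ℝ ℂ) + Polynomial.C Complex.I * Polynomial.derivative (p.map (algebraMap ℝ ℂ))).eval (x : ℂ) = 0 → p.eval x = 0 ∧ (Polynomial.derivative p).eval x = 0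

/-- `PolyDoorRealAxis` holds: proved by `Summit.RiemannHypothesis.RiemannHypothesis.Theorems.Splittings.PolyDoorRealAxis.polyDoorRealAxis`. -/
theorem PolyDoorRealAxis_holds : PolyDoorRealAxis := _root_.Summit.RiemannHypothesis.RiemannHypothesis.Theorems.Splittings.PolyDoorRealAxis.polyDoorRealAxis

/-- item stmt-RiemannHypothesis-21497 · support · rank 9 · closed · proved by Summit.RiemannHypothesis.RiemannHypothesis.Theorems.Splittings.PolyDoorLaguerre.polyDoorLaguerre (prover) · by planner
[support] LINE L12 / B0 «DBR POLYNOMIAL DOOR» (D-0145; registrar rh-split-dbr-neg g16 by verb (ii),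
RULINGS #253/#257) — NODE 2 of 5 (Laguerre direction; M-sized): if every complex root of the real
polynomial p ≠ 0 is real then E_p := p_ℂ + i·p_ℂ′ has no zero in the open upper half-plane (on ℂ₊,
p_ℂ(z) ≠ 0 and p′/p = Σ 1/(z − aⱼ) has negative imaginary part, so 1 + i·p′/p has real part > 1).
E-GENERAL, RH-FREE (Mathlib only: `Polynomial.roots`, splitting over ℂ); = `LaguerreNode` of
LineDbrB0.lean fbf1fd8c172cea0f verbatim (`Iff.rfl`, kernel g16/l12/L12B0Items.lean 2214cd41f05abd8a
rc 0; BC7 probe CLEAN; `exact?` FAIL). Role: with NODE 5 gives the target PolyDoorDichotomy by the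
PROVED glue `dichotomy_of_nodes` (LineDbrB0.lean). NOT in the cone of `closes` (WitnessDetectsRH):
provable rung of the negative-lens mechanism (card §20 COROLLARY M, polynomial shadow =
Laguerre–Pólya ⟹ door zero-free), 0 summit credit. Cheapest falsifier: lineB_num.py 45/45. Sources:
Levin 1964 ch. VII–VIII (Hermite–Biehler, Laguerre–Pólya class); Rahman–Schmeisser, Analytic theory
of polynomials, Gauss–Lucas §2.1; card §20. Nothing here bears on the truth of RH. -/
@[route_item "route-RiemannHypothesis-DeBrangesSuzukiDoor"]
def PolyDoorLaguerre : Prop :=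
  ∀ p : Polynomial ℝ, p ≠ 0 → (∀ z : ℂ, (p.map (algebraMap ℝ ℂ)).eval z = 0 → z.im = 0) → ∀ z : ℂ, 0 < z.im → (p.map (algebraMap ℝ ℂ) + Polynomial.C Complex.I * Polynomial.derivative (p.map (algebraMap ℝ ℂ))).eval z ≠ 0

/-- `PolyDoorLaguerre` holds: proved by `Summit.RiemannHypothesis.RiemannHypothesis.Theorems.Splittings.PolyDoorLaguerre.polyDoorLaguerre`. -/
theorem PolyDoorLaguerre_holds : PolyDoorLaguerre := _root_.Summit.RiemannHypothesis.RiemannHypothesis.Theorems.Splittings.PolyDoorLaguerre.polyDoorLaguerre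

/-- item stmt-RiemannHypothesis-21498 · support · rank 9 · closed · proved by Summit.RiemannHypothesis.RiemannHypothesis.Theorems.Splittings.PolyDoorDomination.polyDoorDomination (prover) · by planner
[support] LINE L12 / B0 «DBR POLYNOMIAL DOOR» (D-0145; registrar rh-split-dbr-neg g16 by verb (ii),
RULINGS #253/#257) — NODE 3 of 5 (half-plane domination; M-sized): if every root of a complex
polynomial q lies in the closed lower half-plane then ‖q^*(z)‖ ≤ ‖q(z)‖ on the open upper
half-plane, q^* := q.map conj (so q^*(z) = conj(q(conj z)); factorwise |z − e| ≥ |z − conj e| for Im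
z > 0 ≥ Im e; q = 0 vacuous-true edge included). E-GENERAL, RH-FREE (Mathlib only); =
`DominationNode` of LineDbrB0.lean fbf1fd8c172cea0f verbatim (`Iff.rfl`, kernel
g16/l12/L12B0Items.lean 2214cd41f05abd8a rc 0; BC7 probe CLEAN; `exact?` FAIL). Role: LOAD-BEARING
for NODE 5 via the PROVED glue `negative_of_nodes : DominationNode → LocalSignNode → NegativeNode`
together with the PROVED identity |a+ib|² − |a−ib|² = 4·Im(a·conj b) (`norm_identity`,
LineDbrB0.lean). NOT in the cone of `closes` (WitnessDetectsRH): provable rung (the polynomial case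
of the de Branges inequality |E(z)| > |E^#(z)| on ℂ₊ for Hermite–Biehler E), 0 summit credit.
Cheapest falsifier: lineB_num.py 45/45. Sources: de Branges, Hilbert spaces of entire functions
(1968) §1–§7; Levin 1964 ch. VII; card §20. Nothing here bears on the trut -/
@[route_item "route-RiemannHypothesis-DeBrangesSuzukiDoor"]
def PolyDoorDomination : Prop :=
  ∀ q : Polynomial ℂ, (∀ e ∈ q.roots, e.im ≤ 0) → ∀ z : ℂ, 0 < z.im → ‖(q.map (starRingEnd ℂ)).eval z‖ ≤ ‖q.eval z‖

/-- `PolyDoorDomination` holds: proved by `Summit.RiemannHypothesis.RiemannHypothesis.Theorems.Splittings.PolyDoorDomination.polyDoorDomination`. -/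
theorem PolyDoorDomination_holds : PolyDoorDomination := _root_.Summit.RiemannHypothesis.RiemannHypothesis.Theorems.Splittings.PolyDoorDomination.polyDoorDomination

/-- item stmt-RiemannHypothesis-21499 · support · rank 9 · closed · proved by Summit.RiemannHypothesis.RiemannHypothesis.Theorems.Splittings.PolyDoorLocalSign.polyDoorLocalSign (prover) · by planner
[support] LINE L12 / B0 «DBR POLYNOMIAL DOOR» (D-0145; registrar rh-split-dbr-neg g16 by verb (ii),
RULINGS #253/#257) — NODE 4 of 5 (local sign; M-sized): if a ∈ ℂ₊ is a root of p_ℂ (p ≠ 0 real) then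
at some point z ∈ ℂ₊ (just below a: z = a − iε) one has Im(p_ℂ(z)·conj(p_ℂ′(z))) < 0 (near a root of
multiplicity m, p·conj p′ ≈ m|c|²|z−a|^{2m−2}(z − a), whose imaginary part is −ε·(positive)).
E-GENERAL, RH-FREE (Mathlib only; a local Taylor/limit estimate at a root); = `LocalSignNode` of
LineDbrB0.lean fbf1fd8c172cea0f verbatim (`Iff.rfl`, kernel g16/l12/L12B0Items.lean 2214cd41f05abd8a
rc 0; BC7 probe CLEAN; `exact?` FAIL). Role: LOAD-BEARING for NODE 5 via the PROVED glue
`negative_of_nodes : DominationNode → LocalSignNode → NegativeNode` (if E_p were zero-free on ℂ₊,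
NODE 3 gives |E_p| ≥ |E_p^*| there, i.e. Im(p conj p′) ≥ 0 on ℂ₊ by `norm_identity` — contradicted
below a). NOT in the cone of `closes` (WitnessDetectsRH): provable rung of the negative lens, 0
summit credit. Cheapest falsifier: lineB_num.py 45/45. Sources: card cards/SPLIT-dbr-neg.md §20
(THEOREM B mechanism), §19 (local count law); Levin 1964 ch. VII. Nothing here bears on the truth of
RH. -/
@[route_item "route-RiemannHypothesis-DeBrangesSuzukiDoor"]
def PolyDoorLocalSign : Prop :=
  ∀ p : Polynomial ℝ, p ≠ 0 → ∀ a : ℂ, 0 < a.im → (p.map (algebraMap ℝ ℂ)).eval a = 0 → ∃ z : ℂ, 0 < z.im ∧ ((p.map (algebraMap ℝ ℂ)).eval z * (starRingEnd ℂ) ((Polynomial.derivative (p.map (algebraMap ℝ ℂ))).eval z)).im < 0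

/-- `PolyDoorLocalSign` holds: proved by `Summit.RiemannHypothesis.RiemannHypothesis.Theorems.Splittings.PolyDoorLocalSign.polyDoorLocalSign`. -/
theorem PolyDoorLocalSign_holds : PolyDoorLocalSign := _root_.Summit.RiemannHypothesis.RiemannHypothesis.Theorems.Splittings.PolyDoorLocalSign.polyDoorLocalSign

/-- item stmt-RiemannHypothesis-21500 · support · rank 9 · closed · proved by Summit.RiemannHypothesis.RiemannHypothesis.Theorems.Splittings.PolyDoorNegative.polyDoorNegative (prover) · by planner
[support] LINE L12 / B0 «DBR POLYNOMIAL DOOR» (D-0145; registrar rh-split-dbr-neg g16 by verb (ii),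
RULINGS #253/#257) — NODE 5 of 5 (the negative lens itself; M-sized given NODES 3+4): a non-real
root of the real polynomial p ≠ 0 forces a zero of E_p := p_ℂ + i·p_ℂ′ in the open upper half-plane.
E-GENERAL, RH-FREE (Mathlib only); = `NegativeNode` of LineDbrB0.lean fbf1fd8c172cea0f verbatim
(`Iff.rfl`, kernel g16/l12/L12B0Items.lean 2214cd41f05abd8a rc 0; BC7 probe CLEAN; `exact?` FAIL).
PROOF ROUTE OF RECORD (kernel-checked glue, no sorry, std axioms, LineDbrB0.lean):
`negative_of_nodes : DominationNode → LocalSignNode → NegativeNode` — so this item closes by porting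
that 30-line proof once PolyDoorDomination (stmt-…-21498) and PolyDoorLocalSign (stmt-…-21499) are
proved; a direct proof (argument principle / Hermite–Biehler) is also admissible. Role: with NODE 2
gives the target PolyDoorDichotomy (`dichotomy_of_nodes`, PROVED). NOT in the cone of `closes`
(WitnessDetectsRH): the polynomial shadow (h = 0) of card §20 THEOREM B «N_{E_A}(ℂ₊) = J + β», 0
summit credit. Cheapest falsifier: lineB_num.py 45/45 (count form). Sources: card §20; Levin 1964
ch. VII (generalized Hermite–Biehl -/
@[route_item "route-RiemannHypothesis-DeBrangesSuzukiDoor"]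
def PolyDoorNegative : Prop :=
  ∀ p : Polynomial ℝ, p ≠ 0 → (∃ z : ℂ, z.im ≠ 0 ∧ (p.map (algebraMap ℝ ℂ)).eval z = 0) → ∃ z : ℂ, 0 < z.im ∧ (p.map (algebraMap ℝ ℂ) + Polynomial.C Complex.I * Polynomial.derivative (p.map (algebraMap ℝ ℂ))).eval z = 0

/-- `PolyDoorNegative` holds: proved by `Summit.RiemannHypothesis.RiemannHypothesis.Theorems.Splittings.PolyDoorNegative.polyDoorNegative`. -/
theorem PolyDoorNegative_holds : PolyDoorNegative := _root_.Summit.RiemannHypothesis.RiemannHypothesis.Theorems.Splittings.PolyDoorNegative.polyDoorNegative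

/-- item stmt-RiemannHypothesis-21501 · support · rank 9 · closed · proved by Summit.RiemannHypothesis.RiemannHypothesis.Theorems.Splittings.PolyDoorDichotomy.polyDoorDichotomy (prover) · by planner
[support] LINE L12 / B0 «DBR POLYNOMIAL DOOR» (D-0145; registrar rh-split-dbr-neg g16 by verb (ii),
RULINGS #253/#257) — TARGET of the line (polynomial door dichotomy = the h = 0 shadow of card §20
COROLLARY M «on real entire functions of finite order with real zeros… E_A zero-free on ℂ₊ ⟺ A ∈
LP»): for a real polynomial p ≠ 0, E_p := p_ℂ + i·p_ℂ′ has no zero in the open upper half-plane iff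
every complex root of p is real. E-GENERAL, RH-FREE (Mathlib only; = the Hermite–Biehler theorem for
the pair (p, p′), both directions); = `DoorDichotomy` of LineDbrB0.lean fbf1fd8c172cea0f verbatim
(`Iff.rfl`, kernel g16/l12/L12B0Items.lean 2214cd41f05abd8a rc 0; BC7 probe CLEAN incl. P5 C→S / S→C
both fail; `exact?` FAIL). PROOF ROUTE OF RECORD: PROVED glue `dichotomy_of_nodes : LaguerreNode →
NegativeNode → DoorDichotomy` (LineDbrB0.lean, no sorry) — closes once PolyDoorLaguerre
(stmt-…-21497) and PolyDoorNegative (stmt-…-21500) are proved. NOT in the cone of `closes`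
(WitnessDetectsRH): the first kernel rung of the negative lens (THEOREM B / COROLLARY M / THEOREM Ψ
family of the card) in the one setting where Mathlib has every object; 0 summit credit; its value is
a certified base case for -/
@[route_item "route-RiemannHypothesis-DeBrangesSuzukiDoor"]
def PolyDoorDichotomy : Prop :=
  ∀ p : Polynomial ℝ, p ≠ 0 → ((∀ z : ℂ, 0 < z.im → (p.map (algebraMap ℝ ℂ) + Polynomial.C Complex.I * Polynomial.derivative (p.map (algebraMap ℝ ℂ))).eval z ≠ 0) ↔ (∀ z : ℂ, (p.map (algebraMap ℝ ℂ)).eval z = 0 → z.im = 0))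

/-- `PolyDoorDichotomy` holds: proved by `Summit.RiemannHypothesis.RiemannHypothesis.Theorems.Splittings.PolyDoorDichotomy.polyDoorDichotomy`. -/
theorem PolyDoorDichotomy_holds : PolyDoorDichotomy := _root_.Summit.RiemannHypothesis.RiemannHypothesis.Theorems.Splittings.PolyDoorDichotomy.polyDoorDichotomy

/-- item stmt-RiemannHypothesis-21502 · support · rank 9 · closed · proved by Summit.RiemannHypothesis.RiemannHypothesis.Theorems.Splittings.PolyDoorCount.polyDoorCount (prover) · by planner
[support] LINE L12 / B0 «DBR POLYNOMIAL DOOR» (D-0145; registrar rh-split-dbr-neg g16 by verb (ii),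
RULINGS #253/#257) — APEX (optional, harder: L-sized; the h = 0 case of card §20 THEOREM B
«N_{E_A}(ℂ₊) = J + β», β = 0): for every real polynomial p, the number of roots of E_p := p_ℂ +
i·p_ℂ′ in the open upper half-plane equals the number of roots of p_ℂ there, WITH MULTIPLICITY
(Multiset.countP on `Polynomial.roots`; p = 0 gives 0 = 0). Proof idea of record: homotopy E_t = p +
i t p′, t ∈ [0,1]: roots of E_t cross ℝ only at common zeros of p and p′, where x₀ of multiplicity m
in p is a root of multiplicity exactly m − 1 of E_t for all t > 0 and the remaining root leaves as
x₀ − i t m (downwards); upper roots of p stay in ℂ₊; continuity of roots + constancy of degree ⟹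
count preserved (alternative: Cauchy index / Hermite–Biehler counting). E-GENERAL, RH-FREE (Mathlib;
needs continuity of polynomial roots in a parameter — the L-sized part); = `DoorCount` of
LineDbrB0.lean fbf1fd8c172cea0f verbatim (`Iff.rfl`, kernel g16/l12/L12B0Items.lean 2214cd41f05abd8a
rc 0; BC7 probe CLEAN; `exact?` FAIL). Implies NODE 5 (glue `upper_of_count`, PROVED). NOT in the
cone of `closes` (WitnessDetec -/
@[route_item "route-RiemannHypothesis-DeBrangesSuzukiDoor"]
def PolyDoorCount : Prop :=
  ∀ p : Polynomial ℝ, (p.map (algebraMap ℝ ℂ) + Polynomial.C Complex.I * Polynomial.derivative (p.map (algebraMap ℝ ℂ))).roots.countP (fun z => 0 < z.im) = (p.map (algebraMap ℝ ℂ)).roots.countP (fun z => 0 < z.im)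

/-- `PolyDoorCount` holds: proved by `Summit.RiemannHypothesis.RiemannHypothesis.Theorems.Splittings.PolyDoorCount.polyDoorCount`. -/
theorem PolyDoorCount_holds : PolyDoorCount := _root_.Summit.RiemannHypothesis.RiemannHypothesis.Theorems.Splittings.PolyDoorCount.polyDoorCount

/-- item stmt-RiemannHypothesis-19731 · assembly · rank 1 · closed · proved by Summit.RiemannHypothesis.RiemannHypothesis.Theorems.assembly_proof @ e3ac6f88013e (prover) · by planner
sources: Suzuki2020IntegralOperators
[assembly] WitnessDetectsRH → DoorWitness → RiemannHypothesis (pick the witness's θ; pure logic). -/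
@[route_item "route-RiemannHypothesis-DeBrangesSuzukiDoor"]
def Assembly : Prop :=
  WitnessDetectsRH → DoorWitness → Summit.RiemannHypothesis

-- `Assembly` holds: proved by `Summit.RiemannHypothesis.RiemannHypothesis.Theorems.assembly_proof` @ e3ac6f88013e (its module imports this route file, so no `_holds` link can be stated here).

attribute [summit_statement] _root_.Summit.RiemannHypothesis.RiemannHypothesis.Theses.DeBrangesSuzukiDoor.WitnessDetectsRH

/-! D-0027 §2.1 — DECIDING THEOREM (planner-authored via `route open/edit --closes-file`; by planner-rh-dbr-theory-g5-0 2026-08-26T00:30:21Z):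
its hypotheses are this route's items and its conclusion the registered leaf `Summit.RiemannHypothesis.RiemannHypothesis.Theses.DeBrangesSuzukiDoor.WitnessDetectsRH` (rung B-P, D-0061) (glue_lint), and it elaborates with this file. -/

@[closes "route-RiemannHypothesis-DeBrangesSuzukiDoor"] theorem closes (hS : KernelSupport) (hL : KernelLaplaceIdentity) (hD : DoorModuloKernel) :
    WitnessDetectsRH :=
  fun θ hθ hMem => hD θ hθ (hS θ hθ) (hL θ hθ) hMem

end Summit.RiemannHypothesis.RiemannHypothesis.Theses.DeBrangesSuzukiDoor
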